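import Summits.Ventures.YMGap.RobustBall.CentreProjectionEven
import Summits.Ventures.YMGap.RobustBall.CentreBlindZ2Domination
import HarnessLib

/-!
# RobustBall/CentreProjectionEvenDomination — MACK–PETKOVA DOMINATION FOR `SU(N)`, `N` EVEN: the whole linkwise centre-blind class of `SU(N)` is
# dominated by `ℤ₂` lattice gauge theory at `β₂ = N|β|`: `|⟨(1/N)tr U_{∂R×T}⟩_{β,W,L}| ≤ z2Loop (N|β|) x i j R T`

HONEST FRAMING: venture file of the cell `pub-ymgap` (QuantumFields programme), track Y2 ROBUST-BALL / DS seat ds-4 (g12; filed by g13 theorem-only, without the perimeter corollary).  WHAT THIS IS: the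
`ℤ₂` sub-twist projection of the tree (`CentreProjectionEven`: for `N` even, `|⟨W⟩| ≤ sup_U ‖z2LoopN β U‖`, the loop of the induced inhomogeneous
`ℤ₂` gauge theory with couplings `J_p(U) = β Re tr U_p`, `|J_p| ≤ N|β|`) followed by GRIFFITHS' COMPARISON exactly as for `N = 2`
(`CentreBlindZ2Domination`: the induced theory is a Friedli–Velenik spin system on the links, the loop observable is the spin product over the odd
support of the boundary, `ZTwo.abs_gksExpect_spinProduct_le`): for EVERY EVEN `N ≥ 2`, every `d`, `L`, `β`, rectangle and twist-blind `W`,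
**`suN_even_abs_wilsonLoop_le_z2Loop : |⟨(1/N) Re tr U_{∂R×T}⟩_{β,W,L}| ≤ ZTwo.z2Loop (N|β|) x i j R T`** — the Wilson loop of `ℤ₂` lattice gauge
theory on the same torus at `β₂ = N|β|`.  CONSEQUENCE: every `ℤ₂`-lattice-gauge-theory torus bound at `β₂ = N|β|` is a bound for the whole `SU(N)`
centre-blind class when `N` is even (`suN_even_abs_wilsonLoop_le_of_z2Loop_le`): the rungs of the `SU(2)` ladder read at `β_W ↦ N|β|` once they are
stated for `z2Loop` (sequels: the SAW-rate rows `CentreBlindSAWRateEven`, the all-coupling perimeter-type bound once `CentreBlindZ2Perimeter` is built).  For `N` odd the centre has no element of order `2` and nothing is claimed.  HONEST LABEL: `N` even only; an inequality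
between finite-torus expectations; no area law asserted here; nothing continuum / spectral / Clay.

References AS PRINTED: G. Mack, V. B. Petkova, Ann. Phys. 123 (1979) 442, §2 [MackPetkova1979]; S. Friedli, Y. Velenik (2017) §3.8.1 [FriedliVelenik2017].
-/

noncomputable section

open Finset
open Literature.MathematicalPhysics.QuantumLattice (fundamentalRep)
open Literature.MathematicalPhysics.QuantumFieldTheory
open Literature.Probability.LatticeModels (spinProduct gksWeight gksExpect gksSum gksHamiltonian)

namespace Summit.Ventures.YMGap.RobustBall

variable {d L N : ℕ} [NeZero L]

omit [NeZero L] in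
/-- The plaquette couplings `J_p(U) = β · Re tr U_p` of the induced `ℤ₂` theory of an `SU(N)` background obey `|J_p(U)| ≤ N|β|` (`|Re tr U_p| ≤ N` on
`SU(N)`). [folklore] -/
theorem abs_z2CouplingN_le (β : ℝ) (U : GaugeConfig d L (SUN N)) (p : Plaquette d L) :
    |β * ((plaquetteHolonomy U p.1 p.2.1.1 p.2.1.2 : SUN N) : Matrix (Fin N) (Fin N) ℂ).trace.re| ≤ N * |β| := by
  rw [abs_mul]
  have h : |((plaquetteHolonomy U p.1 p.2.1.1 p.2.1.2 : SUN N) : Matrix (Fin N) (Fin N) ℂ).trace.re| ≤ N :=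
    (Complex.abs_re_le_norm _).trans (by simpa using norm_trace_le (plaquetteHolonomy U p.1 p.2.1.1 p.2.1.2 : SUN N))
  calc |β| * |((plaquetteHolonomy U p.1 p.2.1.1 p.2.1.2 : SUN N) : Matrix (Fin N) (Fin N) ℂ).trace.re| ≤ |β| * N :=
      mul_le_mul_of_nonneg_left h (abs_nonneg β)
    _ = N * |β| := by ring

/-- **The induced `ℤ₂` theory of an `SU(N)` background is a Friedli–Velenik spin system on the links** (plaquette supports `ZTwo.plaqLinks`).
[folklore] -/
theorem z2WeightN_eq_gksWeight (β : ℝ) (U : GaugeConfig d L (SUN N)) (h : Edge d L → ZMod 2) :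
    z2WeightN β U h =
      gksWeight Finset.univ (fun p : Plaquette d L => β * ((plaquetteHolonomy U p.1 p.2.1.1 p.2.1.2 : SUN N) : Matrix (Fin N) (Fin N) ℂ).trace.re)
        ZTwo.plaqLinks (ZTwo.linkSpin h) := by
  unfold z2WeightN z2Energy gksWeight gksHamiltonian
  congr 1
  rw [Finset.mul_sum]
  refine Finset.sum_congr rfl fun p _ => ?_
  rw [ZTwo.sgn_plaqSum]
  ring

/-- **The induced `ℤ₂` loop is a Friedli–Velenik correlation**: `z2LoopN β U = ⟨σ_{loopLinks}⟩_{univ; J(U)}`. [folklore] -/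
theorem z2LoopN_eq_gksExpect (β : ℝ) (U : GaugeConfig d L (SUN N)) (x : Site d L) (i j : Fin d) (R T : ℕ) :
    z2LoopN β U x i j R T =
      (gksExpect (Finset.univ : Finset (Plaquette d L)) (fun p : Plaquette d L => β * ((plaquetteHolonomy U p.1 p.2.1.1 p.2.1.2 : SUN N) : Matrix (Fin N) (Fin N) ℂ).trace.re)
        ZTwo.plaqLinks (spinProduct (ZTwo.loopLinks x i j R T)) : ℂ) := by
  classical
  set K := (fun p : Plaquette d L => β * ((plaquetteHolonomy U p.1 p.2.1.1 p.2.1.2 : SUN N) : Matrix (Fin N) (Fin N) ℂ).trace.re) with hK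
  have hw : ∀ h, z2WeightN β U h = gksWeight Finset.univ K ZTwo.plaqLinks (ZTwo.linkSpinEquiv h) := fun h => z2WeightN_eq_gksWeight β U h
  have hobs : ∀ h : Edge d L → ZMod 2, (ZTwo.sgn (loopSum h x i j R T) : ℂ) =
      (spinProduct (ZTwo.loopLinks x i j R T) (ZTwo.linkSpinEquiv h) : ℂ) := by
    intro h
    rw [ZTwo.sgn_loopSum]
    rfl
  unfold z2LoopN FiniteGibbs.cavg FiniteGibbs.mass gksExpect gksSum
  simp only [hw, hobs]
  have hnum : ∑ h : Edge d L → ZMod 2, ((gksWeight Finset.univ K ZTwo.plaqLinks (ZTwo.linkSpinEquiv h) : ℝ) : ℂ) *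
        (spinProduct (ZTwo.loopLinks x i j R T) (ZTwo.linkSpinEquiv h) : ℂ) =
      ((∑ ω, spinProduct (ZTwo.loopLinks x i j R T) ω * gksWeight Finset.univ K ZTwo.plaqLinks ω : ℝ) : ℂ) := by
    push_cast
    exact Fintype.sum_equiv ZTwo.linkSpinEquiv _ _ fun h => by ring
  have hden : ∑ h : Edge d L → ZMod 2, gksWeight Finset.univ K ZTwo.plaqLinks (ZTwo.linkSpinEquiv h) =
      ∑ ω, (fun _ => (1 : ℝ)) ω * gksWeight Finset.univ K ZTwo.plaqLinks ω :=
    Fintype.sum_equiv ZTwo.linkSpinEquiv _ _ fun h => by ring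
  rw [hnum, hden]
  push_cast
  rfl

/-- **Griffiths' comparison for the induced loop of an `SU(N)` background**: `‖z2LoopN β U‖ ≤ z2Loop (N|β|)` for EVERY `U`. [folklore] -/
theorem norm_z2LoopN_le_z2Loop (β : ℝ) (U : GaugeConfig d L (SUN N)) (x : Site d L) (i j : Fin d) (R T : ℕ) :
    ‖z2LoopN β U x i j R T‖ ≤ ZTwo.z2Loop ((N : ℝ) * |β|) x i j R T := by
  classical
  rw [z2LoopN_eq_gksExpect, Complex.norm_real, Real.norm_eq_abs]
  exact ZTwo.abs_gksExpect_spinProduct_le _ _ (fun p _ => abs_z2CouplingN_le β U p) _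

/-- **MACK–PETKOVA DOMINATION FOR `SU(N)`, `N` EVEN** (every `d`, `L`, `β`, rectangle, every twist-blind `W`):
`|⟨(1/N) Re tr U_{∂R×T}⟩_{β,W,L}| ≤ ZTwo.z2Loop (N|β|) x i j R T`, the Wilson loop of `ℤ₂` lattice gauge theory on the same torus at `β₂ = N|β|`.
HONEST LABEL: `N` even; finite-torus inequality; no area law asserted. [cite: MackPetkova1979, §2] -/
theorem suN_even_abs_wilsonLoop_le_z2Loop [NeZero N] (hN : Even N) (W : Perturbation d L N) (hW : IsTwistBlind W) (β : ℝ) (x : Site d L) (i j : Fin d)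
    (R T : ℕ) :
    |W.expectation (fundamentalRep (Fin N)) β (wilsonLoop (fundamentalRep (Fin N)) x i j R T)| ≤ ZTwo.z2Loop ((N : ℝ) * |β|) x i j R T :=
  abs_expectation_wilsonLoop_le_of_isTwistBlind_even hN W hW β x i j R T fun U => norm_z2LoopN_le_z2Loop β U x i j R T

/-- The same for rb-theory's `IsCentreBlind`. [cite: MackPetkova1979, §2] -/
theorem suN_even_abs_wilsonLoop_le_z2Loop_of_isCentreBlind [NeZero N] (hN : Even N) (W : Perturbation d L N) (hW : IsCentreBlind W) (β : ℝ)
    (x : Site d L) (i j : Fin d) (R T : ℕ) :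
    |W.expectation (fundamentalRep (Fin N)) β (wilsonLoop (fundamentalRep (Fin N)) x i j R T)| ≤ ZTwo.z2Loop ((N : ℝ) * |β|) x i j R T :=
  suN_even_abs_wilsonLoop_le_z2Loop hN W hW.isTwistBlind β x i j R T

/-- **TRANSFER PRINCIPLE, `N` even**: any bound on the `ℤ₂`-lattice-gauge-theory loop at `β₂ = N|β|` on `(ℤ/L)^d` bounds the same loop for every
member of the `SU(N)` class at tree coupling `β`. [cite: MackPetkova1979, §2] -/
theorem suN_even_abs_wilsonLoop_le_of_z2Loop_le [NeZero N] (hN : Even N) {β B : ℝ} {x : Site d L} {i j : Fin d} {R T : ℕ}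
    (hB : ZTwo.z2Loop ((N : ℝ) * |β|) x i j R T ≤ B) (W : Perturbation d L N) (hW : IsTwistBlind W) :
    |W.expectation (fundamentalRep (Fin N)) β (wilsonLoop (fundamentalRep (Fin N)) x i j R T)| ≤ B :=
  (suN_even_abs_wilsonLoop_le_z2Loop hN W hW β x i j R T).trans hB

end Summit.Ventures.YMGap.RobustBall

end
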